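import Literature.AlgebraicGeometry.Resolution.WeightedCentreHeavyBaseCase
import Literature.AlgebraicGeometry.Resolution.WeightedCentreLowestClassKill
import Literature.AlgebraicGeometry.Resolution.WeightedCentreClassPinBridge
import Literature.AlgebraicGeometry.Resolution.WeightedCentreKillPin
import Literature.AlgebraicGeometry.Resolution.WeightedCentreRZToolkit
import HarnessLib

/-!
# THEOREM 𝔉′ ASSEMBLED from (H′), (L0′) and the derived-flow step (L1′) (engine 1's `W(f)` toy model — an instrument, NOT a
# resolution theorem)

RE-DERIVATION-eng1-g44 §3.3, THEOREM 𝔉′: "a (P)-menu carries no tailed light flow of any unit".  Its proof is an induction on the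
number of light classes: (H′) all light slots fixed ⇒ contradiction (`IsTailedLightFlow.false_of_light_fixed`, tree); (L0′) the lowest
moved light slot `y` has a CONSTANT datum `𝔇ε_y = c ≠ 0` ⇒ (P) fails at the class of `y` in the kill coordinates
(`IsTailedLightFlow.not_classPinned_kill`, tree); (L1′) the lowest moved light datum is NON-constant ⇒ a DERIVED tailed light flow on the
face `h' = h|_{Z″ = 0}` (`Z″ =` the slots lighter than `y`), to which the theorem applies by induction.

This file is the KERNEL-CHECKED ASSEMBLY: it types the exact output statement of (L1′) that the induction consumes —
`DerivedFaceStep p u w h` (faces are modelled on the SAME index type: `face w c h := killLight (c ≤ w ·) h` kills the slots of weight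
`< c`; a flow on a face is required to be `SupportedAbove` the threshold, i.e. its derivation vanishes on the killed slots and its data
involve no killed variable — without this a face carries junk flows moving only killed variables) — and proves

  `noTailedLightFlow_of_derivedFaceStep : (P) at every non-`V` slot → DerivedFaceStep p u w h → NoTailedLightFlow p u w h`

by strong induction on the number of light weight values `≥ c`, with (H′) and (L0′) imported from the tree and (P) transported to
faces and kill coordinates (§1: `SlotPinned` is inherited by faces, `Truncation.slotPinned_killLight_iff`; composed with a graded
automorphism pair it yields the class-linear pin condition `ClassPinned` consumed by (H′)/(L0′)).  (L1′) itself
(`DerivedFaceStep`, engine: generic `λ`-weight + weight filtration + leading forms) is NOT proved here; it is the one remaining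
hypothesis, typed so that a proof of it closes THEOREM 𝔉′ by `noTailedLightFlow_of_derivedFaceStep`.

HONEST FRAMING.  Commutative algebra of truncated exponentials of triangular derivations on a weighted polynomial ring
([Matsumura1987, §27 (pp. 207–209), §25]; weighted gradings / graded coordinate changes as in [AbramovichTemkinWlodarczyk2024,
§5.1 (p. 1575), Thm. 5.3.1 (2)-(3) (p. 1578)]; substitutions [Lang2002, Ch. IV §1, Ch. XIII §4]).  Statements engine 1's (cell
pub-rosobs), formalisation OURS; an instrument for the cell's `W(f)` TOY MODEL — NOT a resolution theorem, NOT a statement about the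
invariant of [AbramovichTemkinWlodarczyk2024], NOT summit progress.
-/

namespace Literature.AlgebraicGeometry.Resolution.WeightedBlowup

/-! ## 1. Transport of (P): along graded automorphism pairs, to faces, to the core -/

section PinTransport

open MvPolynomial Truncation InvariantDirection

variable {L : Type*} [Field L] {ι : Type*} [Fintype ι] [DecidableEq ι] (w : ι → ℚ)

omit [Fintype ι] [DecidableEq ι] in
/-- Graded automorphism pairs compose (bookkeeping). [cite: AbramovichTemkinWlodarczyk2024, §5.1 (p. 1575)] -/
theorem Truncation.IsGradedAutPair.comp {Φ Φ' Ψ Ψ' : MvPolynomial ι L →ₐ[L] MvPolynomial ι L} (hΦ : IsGradedAutPair w Φ Φ')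
    (hΨ : IsGradedAutPair w Ψ Ψ') : IsGradedAutPair w (Φ.comp Ψ) (Ψ'.comp Φ') :=
  ⟨fun i => by rw [AlgHom.comp_apply]; exact hΦ.1.isWeightedHomogeneous_apply (hΨ.1 i),
    fun i => by rw [AlgHom.comp_apply]; exact hΨ.2.1.isWeightedHomogeneous_apply (hΦ.2.1 i),
    fun g => by rw [AlgHom.comp_apply, AlgHom.comp_apply, hΨ.2.2.1, hΦ.2.2.1],
    fun g => by rw [AlgHom.comp_apply, AlgHom.comp_apply, hΦ.2.2.2, hΨ.2.2.2]⟩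

omit [Fintype ι] [DecidableEq ι] in
/-- An algebra automorphism graded in both directions is a graded automorphism pair (bookkeeping).
[cite: AbramovichTemkinWlodarczyk2024, §5.1 (p. 1575)] -/
theorem Truncation.isGradedAutPair_algEquiv {e : MvPolynomial ι L ≃ₐ[L] MvPolynomial ι L}
    (he : IsGraded w (e : MvPolynomial ι L →ₐ[L] MvPolynomial ι L))
    (he' : IsGraded w (e.symm : MvPolynomial ι L →ₐ[L] MvPolynomial ι L)) :
    IsGradedAutPair w (e : MvPolynomial ι L →ₐ[L] MvPolynomial ι L) (e.symm : MvPolynomial ι L →ₐ[L] MvPolynomial ι L) :=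
  ⟨he, he', fun g => by simp, fun g => by simp⟩

/-- **(P) transported along a graded automorphism pair gives the class-linear pin condition** (ours): if `X_l` is (P)-pinned in `g`
then for every graded automorphism pair `(Ψ, Ψ')`, `Ψ g` is `ClassPinned` at `l` for the weight class of `l` —
compose `(Ψ, Ψ')` with the graded pair `(∘A, ∘A⁻¹)` of an invertible class-linear `A` and forget the truncation.
[cite: AbramovichTemkinWlodarczyk2024, §5.1 (p. 1575)] [cite: Lang2002, Ch. XIII §4] -/
theorem Truncation.SlotPinned.classPinned_apply {l : ι} {g : MvPolynomial ι L} (hl : SlotPinned w l g)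
    {Ψ Ψ' : MvPolynomial ι L →ₐ[L] MvPolynomial ι L} (hΨ : IsGradedAutPair w Ψ Ψ') :
    ClassPinned (Finset.univ.filter fun j => w j = w l) (Ψ g) l := by
  intro A A' hAA' hA'A hA
  have hS : ∀ j ∈ Finset.univ.filter (fun j => w j = w l), ∀ k ∈ Finset.univ.filter (fun j => w j = w l), w j = w k :=
    fun j hj k hk => by rw [(Finset.mem_filter.mp hj).2, (Finset.mem_filter.mp hk).2]
  have h := hl _ _ ((hA.isGradedAutPair_linSubst w hAA' hA'A hS).comp w hΨ)
  rw [IsPinnedIn, AlgHom.comp_apply] at h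
  exact vars_killLight_subset _ _ h

/-- **The class-linear pin condition descends from a face** (ours, bookkeeping): if the class `S` is kept by `H` then
`ClassPinned S (killLight H P) l → ClassPinned S P l` (a class-linear substitution on a kept class commutes with the killing).
[cite: Lang2002, Ch. XIII §4] -/
theorem InvariantDirection.ClassPinned.of_killLight (H : ι → Prop) [DecidablePred H] {S : Finset ι} (hS : ∀ j ∈ S, H j)
    {P : MvPolynomial ι L} {l : ι} (h : ClassPinned S (killLight H P) l) : ClassPinned S P l := by
  intro A A' hAA' hA'A hA
  have h1 := h A A' hAA' hA'A hA
  rw [← RZToolkit.killLight_linSubst H hA hS] at h1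
  exact vars_killLight_subset _ _ h1

/-- **(P) at a heavy slot gives the class-pin hypothesis of (H′) on every face** (ours): for `c ≤ w_l`, `p ≤ w_l` and positive
weights, `SlotPinned w l g` implies that the CORE `killLight (¬ w < p) (face_c g)` of the face `face_c g = killLight (c ≤ w ·) g` is
`ClassPinned` at `l` for the weight class of `l` ((P) is inherited by the face, `slotPinned_killLight_iff`; the bridge
`SlotPinned.classPinned_killLight`; nested kills). [cite: AbramovichTemkinWlodarczyk2024, §5.1 (p. 1575)] -/
theorem Truncation.SlotPinned.classPinned_core_face (hw : ∀ j, 0 < w j) {p : ℕ} {c : ℚ} {l : ι} (hcl : c ≤ w l)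
    (hpl : (p : ℚ) ≤ w l) {g : MvPolynomial ι L} (hl : SlotPinned w l g) :
    ClassPinned (Finset.univ.filter fun j => w j = w l)
      (killLight (fun i => ¬ w i < p) (killLight (fun j => c ≤ w j) g)) l := by
  have h1 : SlotPinned w l (killLight (fun j => c ≤ w j) g) :=
    (slotPinned_killLight_iff w (hw l) (fun i _ => (hw i).ne') hcl g).mpr hl
  have h2 := Truncation.SlotPinned.classPinned_killLight w hw h1
  refine ClassPinned.of_killLight (fun j => w l ≤ w j) (fun j hj => (Finset.mem_filter.mp hj).2.ge) ?_
  rwa [killLight_killLight_of_imp (fun i => ¬ w i < (p : ℚ)) (fun j => w l ≤ w j) (fun i hi => not_lt.mpr (hpl.trans hi))]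

end PinTransport

/-! ## 2. Faces, supported flows, the (L1′) output statement, and THEOREM 𝔉′ assembled -/

namespace TailedLightFlow

open Truncation InvariantDirection
open scoped Nat

variable {k : Type*} [Field k] {ι : Type*} [Fintype ι] [DecidableEq ι]

/-- The FACE of `h` at the threshold `c`: the slots of weight `< c` killed (engine: `h' = h|_{Z″ = 0}`; modelled on the same index type;
construction). [cite: AbramovichTemkinWlodarczyk2024, §5.1 (p. 1575)] -/
noncomputable def face (w : ι → ℚ) (c : ℚ) (h : MvPolynomial ι k) : MvPolynomial ι k := killLight (fun j => c ≤ w j) h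

omit [Fintype ι] [DecidableEq ι] in
/-- Bookkeeping: `face` unfolds to `killLight (c ≤ w ·)`. [cite: AbramovichTemkinWlodarczyk2024, §5.1 (p. 1575)] -/
theorem face_eq (w : ι → ℚ) (c : ℚ) (h : MvPolynomial ι k) : face w c h = killLight (fun j => c ≤ w j) h := rfl

omit [Fintype ι] [DecidableEq ι] in
/-- Nested faces: `face_{c'} (face_c h) = face_{c'} h` for `c ≤ c'` (bookkeeping). [cite: AbramovichTemkinWlodarczyk2024, §5.1 (p. 1575)] -/
theorem face_face_of_le (w : ι → ℚ) {c c' : ℚ} (hcc' : c ≤ c') (h : MvPolynomial ι k) : face w c' (face w c h) = face w c' h :=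
  killLight_killLight_of_le w hcc' h

omit [Fintype ι] [DecidableEq ι] in
/-- The face at a threshold below every weight is `h` itself (bookkeeping). [cite: AbramovichTemkinWlodarczyk2024, §5.1 (p. 1575)] -/
theorem face_eq_self_of_forall_le (w : ι → ℚ) {c : ℚ} (hc : ∀ i, c ≤ w i) (h : MvPolynomial ι k) : face w c h = h := by
  have hH : heavyX (S := k) (fun j => c ≤ w j) = MvPolynomial.X := funext fun i => by rw [heavyX, if_pos (hc i)]
  show MvPolynomial.aeval (heavyX (S := k) fun j => c ≤ w j) h = h
  rw [hH, MvPolynomial.aeval_X_left, AlgHom.id_apply]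

/-- A derivation SUPPORTED ABOVE the threshold `c`: it vanishes on the slots of weight `< c` and its data involve no variable of
weight `< c` (the honest bookkeeping of "a flow of the face `h|_{Z″=0}` lives on the ring without the `Z″`-variables"; ours).
[cite: Matsumura1987, §25] -/
def SupportedAbove (w : ι → ℚ) (c : ℚ) (D : Derivation k (MvPolynomial ι k) (MvPolynomial ι k)) : Prop :=
  (∀ i, w i < c → D (MvPolynomial.X i) = 0) ∧ ∀ i, ∀ j ∈ (D (MvPolynomial.X i)).vars, c ≤ w j

omit [Fintype ι] [DecidableEq ι] in
/-- Every derivation is supported above a threshold below every weight (bookkeeping). [cite: Matsumura1987, §25] -/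
theorem supportedAbove_of_forall_le (w : ι → ℚ) {c : ℚ} (hc : ∀ i, c ≤ w i)
    (D : Derivation k (MvPolynomial ι k) (MvPolynomial ι k)) : SupportedAbove w c D :=
  ⟨fun i hi => absurd (hc i) (not_le.mpr hi), fun _ j _ => hc j⟩

/-- **The typed OUTPUT STATEMENT of step (L1′)** (RE-DERIVATION-eng1-g44 §3.3; a `Prop`, ours — NOT proved in this file): whenever a
face `face_c h` carries a tailed light flow `(𝔇, q)` of some unit whose lowest moved light slot `y` (`𝔇 = 0` on every slot lighter
than `y`, `c ≤ w_y`) has a NON-CONSTANT datum (`𝔇ε_y` involves some variable `j`), the smaller face `face_{w_y} h = h|_{Z″=0}`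
(`Z″ =` the slots lighter than `y`) carries a tailed light flow of some unit supported above `w_y` (engine: the DERIVED flow
`(𝔇₂, q₂)` of unit `θ₂ = θ + ω(γ₀)`, resp. the pure-tail flow `(𝔇_u, 0)`, extracted by a generic `λ`-weight on `Z″`, the weight
filtration and the leading-form principle). [cite: Matsumura1987, §27 (pp. 207–209)] [cite: Lang2002, Ch. IV §1] -/
def DerivedFaceStep (p : ℕ) (u : ℕ → k) (w : ι → ℚ) (h : MvPolynomial ι k) : Prop :=
  ∀ (c θ : ℚ) (D : Derivation k (MvPolynomial ι k) (MvPolynomial ι k)) (q : ι → MvPolynomial ι k) (y j : ι),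
    IsTailedLightFlow p u w θ (face w c h) D q → c ≤ w y → w y < p → (∀ i, w i < w y → D (MvPolynomial.X i) = 0) →
      j ∈ (D (MvPolynomial.X y)).vars →
        ∃ (θ' : ℚ) (D' : Derivation k (MvPolynomial ι k) (MvPolynomial ι k)) (q' : ι → MvPolynomial ι k),
          IsTailedLightFlow p u w θ' (face w (w y) h) D' q' ∧ SupportedAbove w (w y) D'

omit [Fintype ι] [DecidableEq ι] in
/-- A polynomial without variables is a constant (bookkeeping). [cite: Lang2002, Ch. IV §1] -/
theorem eq_C_of_vars_eq_empty {P : MvPolynomial ι k} (hP : P.vars = ∅) : P = MvPolynomial.C (MvPolynomial.coeff 0 P) := by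
  apply MvPolynomial.totalDegree_eq_zero_iff_eq_C.mp
  apply Nat.eq_zero_of_le_zero
  refine Finset.sup_le fun d hd => ?_
  have hd0 : d = 0 := by
    ext i
    by_contra hne
    have hi : i ∈ P.vars := (MvPolynomial.mem_vars_iff_mem_support i).mpr ⟨d, hd, Finsupp.mem_support_iff.mpr hne⟩
    rw [hP] at hi
    exact absurd hi (Finset.notMem_empty i)
  rw [hd0]
  simp

/-- The number of light weight VALUES `≥ c` — the induction measure of THEOREM 𝔉′ ("the number of light classes of the face";
ours, bookkeeping). [cite: AbramovichTemkinWlodarczyk2024, §5.1 (p. 1575)] -/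
noncomputable def lightClassCount (p : ℕ) (w : ι → ℚ) (c : ℚ) : ℕ :=
  ((Finset.univ.filter fun i => w i < p ∧ c ≤ w i).image w).card

omit [DecidableEq ι] in
/-- The measure drops strictly from `c` to `w_y` when a light weight value `w_j` lies in `[c, w_y)` (bookkeeping).
[cite: AbramovichTemkinWlodarczyk2024, §5.1 (p. 1575)] -/
theorem lightClassCount_lt {p : ℕ} {w : ι → ℚ} {c : ℚ} {y j : ι} (hcy : c ≤ w y) (hjp : w j < p) (hcj : c ≤ w j)
    (hjy : w j < w y) : lightClassCount p w (w y) < lightClassCount p w c := by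
  classical
  unfold lightClassCount
  refine Finset.card_lt_card ((Finset.ssubset_iff_of_subset ?_).mpr ⟨w j, ?_, ?_⟩)
  · intro v hv
    simp only [Finset.mem_image, Finset.mem_filter, Finset.mem_univ, true_and] at hv ⊢
    obtain ⟨i, ⟨hip, hyi⟩, rfl⟩ := hv
    exact ⟨i, ⟨hip, hcy.trans hyi⟩, rfl⟩
  · simp only [Finset.mem_image, Finset.mem_filter, Finset.mem_univ, true_and]
    exact ⟨j, ⟨hjp, hcj⟩, rfl⟩
  · simp only [Finset.mem_image, Finset.mem_filter, Finset.mem_univ, true_and, not_exists, not_and, and_imp]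
    intro i _ hyi hij
    rw [hij] at hyi
    exact absurd hjy (not_lt.mpr hyi)

namespace IsTailedLightFlow

variable {p : ℕ} {u : ℕ → k} {w : ι → ℚ} {θ : ℚ} {h : MvPolynomial ι k} {D : Derivation k (MvPolynomial ι k) (MvPolynomial ι k)}
  {q : ι → MvPolynomial ι k}

/-- The kill coordinates `(Λ⁻¹, Λ)` of step (L0′) are a graded automorphism pair (bookkeeping over `isWeightedHomogeneous_kill`).
[cite: AbramovichTemkinWlodarczyk2024, Lemma 5.2.10 (p. 1577)] -/
theorem isGradedAutPair_kill_symm (F : IsTailedLightFlow p u w θ h D q) (hu : ∀ n < p, ((n ! : ℕ) : k) * u n = 1) (hp : 1 < p)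
    {y : ι} {c : k} (hc : c ≠ 0) (hy : D (MvPolynomial.X y) = MvPolynomial.C c) (hwy : w y < p)
    (hlow : ∀ i, w i < w y → D (MvPolynomial.X i) = 0) :
    IsGradedAutPair w ((F.kill hu hp y c hwy hlow).symm : MvPolynomial ι k →ₐ[k] MvPolynomial ι k)
      (F.kill hu hp y c hwy hlow : MvPolynomial ι k →ₐ[k] MvPolynomial ι k) := by
  refine ⟨fun i => ?_, fun i => ?_, fun g => by simp, fun g => by simp⟩
  · simpa using (F.isWeightedHomogeneous_kill hu hp hc hy hwy hlow (MvPolynomial.isWeightedHomogeneous_X k w i)).2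
  · simpa using (F.isWeightedHomogeneous_kill hu hp hc hy hwy hlow (MvPolynomial.isWeightedHomogeneous_X k w i)).1

end IsTailedLightFlow

section TheoremFPrime

variable {p : ℕ} {u : ℕ → k} {w : ι → ℚ} {h : MvPolynomial ι k}

/-- **THEOREM 𝔉′ on every face, by strong induction on the number of light classes** (ours; the engine's induction made explicit):
under `b!·u_b = 1 (b < p)`, `1 < p`, positive weights, (P) (`SlotPinned`) at every slot of weight `≤ p + 1` and the derived-flow
step (L1′), NO face `face_c h` (`c ≤ p`) carries a tailed light flow supported above `c`.  Cases: all light slots fixed ⇒ (H′)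
(`false_of_light_fixed`, pins from §1); lowest moved light slot `y` with constant datum ⇒ (L0′) (`not_classPinned_kill` against
`SlotPinned.classPinned_apply` in the kill coordinates); non-constant datum ⇒ (L1′) and the induction hypothesis at `w_y`
(`lightClassCount_lt`). [cite: Matsumura1987, §27 (pp. 207–209)] [cite: AbramovichTemkinWlodarczyk2024, §5.1 (p. 1575)] -/
theorem not_isTailedLightFlow_face (hu : ∀ n < p, ((n ! : ℕ) : k) * u n = 1) (hp : 1 < p) (hw : ∀ i, 0 < w i)
    (hP : ∀ l, w l ≤ (p : ℚ) + 1 → SlotPinned w l h) (hL1 : DerivedFaceStep p u w h) :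
    ∀ (n : ℕ) (c : ℚ), c ≤ p → lightClassCount p w c = n →
      ∀ (θ : ℚ) (D : Derivation k (MvPolynomial ι k) (MvPolynomial ι k)) (q : ι → MvPolynomial ι k),
        IsTailedLightFlow p u w θ (face w c h) D q → SupportedAbove w c D → False := by
  classical
  intro n
  induction n using Nat.strong_induction_on with
  | _ n IH =>
  intro c hcp hcard θ D q F hS
  by_cases hfix : ∀ i, w i < p → D (MvPolynomial.X i) = 0
  · -- (H′): every light slot is fixed
    refine F.false_of_light_fixed hu hp (fun i _ => hw i) hfix (fun j hj => ?_) (fun j hj => ?_)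
    · have hjp : ¬ w j < p := fun h' => hj (hfix j h')
      have hjV : ¬ (p : ℚ) + 1 < w j := fun h' => hj (F.D_X_eq_zero j h')
      have hcj : c ≤ w j := hcp.trans (not_lt.mp hjp)
      exact (hP j (not_lt.mp hjV)).classPinned_core_face w hw hcj (not_lt.mp hjp)
    · have hjp : ¬ w j < p := fun h' => hj (F.q_eq_zero j (Or.inl h'))
      have hjV : ¬ (p : ℚ) + 1 < w j := fun h' => hj (F.q_eq_zero j (Or.inr h'))
      have hcj : c ≤ w j := hcp.trans (not_lt.mp hjp)
      exact (hP j (not_lt.mp hjV)).classPinned_core_face w hw hcj (not_lt.mp hjp)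
  · -- a lowest moved light slot `y`
    push Not at hfix
    obtain ⟨i₀, hi₀p, hi₀⟩ := hfix
    obtain ⟨y, hyM, hymin⟩ := Finset.exists_min_image (Finset.univ.filter fun i => w i < p ∧ D (MvPolynomial.X i) ≠ 0) w
      ⟨i₀, Finset.mem_filter.mpr ⟨Finset.mem_univ _, hi₀p, hi₀⟩⟩
    obtain ⟨hwy, hDy⟩ := (Finset.mem_filter.mp hyM).2
    have hlow : ∀ i, w i < w y → D (MvPolynomial.X i) = 0 := by
      intro i hi
      by_contra hne
      exact (not_le.mpr hi) (hymin i (Finset.mem_filter.mpr ⟨Finset.mem_univ _, hi.trans hwy, hne⟩))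
    have hcy : c ≤ w y := by
      by_contra h'
      exact hDy (hS.1 y (not_le.mp h'))
    by_cases hvars : (D (MvPolynomial.X y)).vars = ∅
    · -- (L0′): constant datum
      have hC := eq_C_of_vars_eq_empty hvars
      have hc₀ : MvPolynomial.coeff 0 (D (MvPolynomial.X y)) ≠ 0 := fun h0 => hDy (by rw [hC, h0, MvPolynomial.C_0])
      have hpin : SlotPinned w y (face w c h) :=
        (slotPinned_killLight_iff w (hw y) (fun i _ => (hw i).ne') hcy h).mpr
          (hP y (hwy.le.trans (le_add_of_nonneg_right zero_le_one)))
      have hcp := hpin.classPinned_apply w (F.isGradedAutPair_kill_symm hu hp hc₀ hC hwy hlow)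
      rw [AlgEquiv.coe_toAlgHom] at hcp
      exact F.not_classPinned_kill hu hp hc₀ hC hwy hlow (S := Finset.univ.filter fun j => w j = w y)
        (Finset.mem_filter.mpr ⟨Finset.mem_univ y, rfl⟩) hcp
    · -- (L1′): non-constant datum ⇒ derived flow on the smaller face
      obtain ⟨j, hj⟩ := Finset.nonempty_iff_ne_empty.mpr hvars
      obtain ⟨θ', D', q', F', hS'⟩ := hL1 c θ D q y j F hcy hwy hlow hj
      have hjw := F.vars_D y j hj
      exact IH (lightClassCount p w (w y)) (hcard ▸ lightClassCount_lt hcy hjw.1 (hS.2 y j hj) hjw.2) (w y) hwy.le rfl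
        θ' D' q' F' hS'

/-- **THEOREM 𝔉′ ASSEMBLED** (RE-DERIVATION-eng1-g44 §3.3; ours): under `b!·u_b = 1 (b < p)`, `1 < p`, positive weights and (P)
(`SlotPinned`) at every slot of weight `≤ p + 1`, the derived-flow step (L1′) (`DerivedFaceStep p u w h`) implies that the menu `h`
carries NO tailed light flow of any unit: `NoTailedLightFlow p u w h` (the face at threshold `0` is `h`, every flow is supported above
`0`).  The remaining hypothesis `DerivedFaceStep` is exactly step (L1′); (H′) and (L0′) are the tree's theorems.
[cite: Matsumura1987, §27 (pp. 207–209)] [cite: AbramovichTemkinWlodarczyk2024, §5.1 (p. 1575), Thm. 5.3.1 (2)-(3) (p. 1578)] -/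
theorem noTailedLightFlow_of_derivedFaceStep (hu : ∀ n < p, ((n ! : ℕ) : k) * u n = 1) (hp : 1 < p) (hw : ∀ i, 0 < w i)
    (hP : ∀ l, w l ≤ (p : ℚ) + 1 → SlotPinned w l h) (hL1 : DerivedFaceStep p u w h) : NoTailedLightFlow p u w h := by
  intro θ D q F
  have h0 : face w 0 h = h := face_eq_self_of_forall_le w (fun i => (hw i).le) h
  exact not_isTailedLightFlow_face hu hp hw hP hL1 _ 0 (Nat.cast_nonneg p) rfl θ D q (h0.symm ▸ F)
    (supportedAbove_of_forall_le w (fun i => (hw i).le) D)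

end TheoremFPrime

end TailedLightFlow

end Literature.AlgebraicGeometry.Resolution.WeightedBlowup
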